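import Mathlib.Topology.Baire.Lemmas
import Mathlib.Topology.Baire.CompleteMetrizable
import Mathlib.Analysis.InnerProductSpace.PiL2
import Mathlib.Analysis.Calculus.ContDiff.Operations
import Literature.Geometry.Lorentzian.FinalState
import Literature.Geometry.Lorentzian.Genericity
import HarnessLib

/-!
# Route PhotonSphereChannels · crux `TameCensorship` (stmt-FinalStateConjecture-17431) · line `Sketch`, skeleton v9 ·
# read-back of the RESIDUAL legend: which exceptional-set structures it tolerates (conical: yes; countably many curved walls: no)

Helper file (`--supports stmt-FinalStateConjecture-17431`; route seat 0, 2026-08-17) for the v9 reshape of line `Sketch`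
(lead c4): the two open kernels `stub_fgExtremalChartFreeResidual` / `stub_tameOuterResidual` ask, along every further
enrichment `G₂ : ℝᵖ → data` of an enriched probe, for a RESIDUAL (comeagre) set `U ⊆ ℝᵖ` of radial directions `v`
each carrying a punctured interval `0 < |t| < δ(v)` of `Q`-good parameters `t • v`. The skeleton motivates the
weakening "open dense ↦ residual" by tolerance of "countably many `C¹` strata through the datum". This file certifies
what the residual legend does and does not tolerate, in the def-free house shape of the landed finite-walls brick
`stub_robustOfWalls` (p136583, `Theorems/PhotonSphereChannelsTameCensorshipRobustOfWalls.lean`):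

* `residual_radialEscape_of_conical` (abstract, any `ℝᵖ`): if the bad parameters of norm `< ε` lie on countably many
  CLOSED, NOWHERE-DENSE, RADIAL (scale-invariant: `t • v ∈ Cⱼ, t ≠ 0 ⇒ v ∈ Cⱼ`) sets `Cⱼ` — countably many
  hyperplanes or closed cones through the datum — then the directions off `⋃ Cⱼ` form a residual set and every such
  direction is good for `0 < |t| < ε / (‖v‖ + 1)`. This is exactly what v9 buys over v8 (for finitely many `Cⱼ` the
  same set is open dense).
* `residualOfConicalWalls` (def-free, data level): the corresponding sufficient condition for the residual kernels,
  verbatim in the shape of `stub_robustOfWalls` with the finite `C¹` walls replaced by countably many conical ones.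
* `not_residual_radialEscape_countableWalls` (abstract, `ℝ²`): countably many CURVED walls through the datum are NOT
  tolerated — for the parabolas `φⱼ(c) = c₁ − (j+1)·c₀²` (each polynomial, `φⱼ 0 = 0`, `dφⱼ(0) = dc₁ ≠ 0`: the literal
  countable version of the hypothesis block of `stub_robustOfWalls`, even with every parameter off the walls declared
  good) NO residual set of directions carries punctured intervals of good parameters: along every direction with
  `v₀ ≠ 0`, `v₁ ≠ 0` the wall `j` is met at `t = v₁ / ((j+1) v₀²) → 0` (radial accumulation), and a residual subset of
  the Baire space `ℝ²` is dense, so it meets the open quadrant `{v₀ > 0, v₁ > 0}`.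

Consequence for the planners' promotion of the v9 kernels (memo K3T2-seat0-residual-legend-walls.md on the item): the
residual legend differs from the robust one only by "comeagre" versus "open dense" direction sets; both stand or fall
with the absence of RADIAL ACCUMULATION of bad parameters at the datum, which countably many curved `C¹` strata through
`d` (unbounded curvatures, or bounded curvatures with a dense set of tangent hyperplanes) do produce. Finite-dimensional
analysis only; Mathlib `residual`, `countable_iInter_mem`, `dense_of_mem_residual`. [folklore]
-/

set_option linter.dupNamespace false

open Literature.Geometry.Lorentzian
open scoped Manifold ContDiff Topology
open Filter Set Function

noncomputable section

namespace Summit.FinalStateConjecture.FinalStateConjecture.Theorems.PhotonSphereChannels.TameCensorshipUnwind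

/-- **Conical exceptional sets are escaped residually.** In `ℝᵖ`, let `Cⱼ` (`j ∈ ℕ`) be closed sets with dense
complements (closed nowhere-dense sets) which are RADIAL — `t • v ∈ Cⱼ` with `t ≠ 0` forces `v ∈ Cⱼ` (hyperplanes
and closed cones through `0`) — and suppose every parameter `c` with `‖c‖ < ε` off all `Cⱼ` is good. Then a residual
set of directions `v` (namely `⋂ⱼ Cⱼᶜ`, a countable intersection of dense open sets) is good for all `0 < |t| < δ`,
with the explicit radius `δ = ε / (‖v‖ + 1)`. [folklore] -/
theorem residual_radialEscape_of_conical {p : ℕ} (good : EuclideanSpace ℝ (Fin p) → Prop)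
    (C : ℕ → Set (EuclideanSpace ℝ (Fin p))) (ε : ℝ) (hε : 0 < ε) (hC : ∀ j, IsClosed (C j))
    (hCd : ∀ j, Dense (C j)ᶜ)
    (hrad : ∀ j (v : EuclideanSpace ℝ (Fin p)) (t : ℝ), t ≠ 0 → t • v ∈ C j → v ∈ C j)
    (hgood : ∀ c : EuclideanSpace ℝ (Fin p), ‖c‖ < ε → (∀ j, c ∉ C j) → good c) :
    ∃ U : Set (EuclideanSpace ℝ (Fin p)), U ∈ residual (EuclideanSpace ℝ (Fin p)) ∧
      ∀ v ∈ U, ∃ δ : ℝ, 0 < δ ∧ ∀ t : ℝ, t ≠ 0 → |t| < δ → good (t • v) := by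
  refine ⟨⋂ j, (C j)ᶜ, (countable_iInter_mem).2 fun j => residual_of_dense_open (hC j).isOpen_compl (hCd j),
    fun v hv => ?_⟩
  have hvj : ∀ j, v ∉ C j := fun j => Set.mem_iInter.1 hv j
  have hv1 : 0 < ‖v‖ + 1 := by positivity
  refine ⟨ε / (‖v‖ + 1), div_pos hε hv1, fun t ht htδ => hgood (t • v) ?_ fun j htv => hvj j (hrad j v t ht htv)⟩
  have h1 : |t| * (‖v‖ + 1) < ε := (lt_div_iff₀ hv1).1 htδ
  calc ‖t • v‖ = |t| * ‖v‖ := by rw [norm_smul, Real.norm_eq_abs]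
    _ ≤ |t| * (‖v‖ + 1) := mul_le_mul_of_nonneg_left (by linarith) (abs_nonneg t)
    _ < ε := h1

/-- **`residualOfConicalWalls` (sufficient condition for the RESIDUAL kernels of skeleton v9, abstract `Q`; the
countable-conical analogue of `stub_robustOfWalls`).** Suppose every compactly supported smooth admissible probe through
`d` enriches (injective linear `L`) so that along EVERY further enrichment `G₂ : ℝᵖ → data` there are countably many
closed nowhere-dense RADIAL sets `Cⱼ ⊆ ℝᵖ` and a radius `ε > 0` such that every parameter `c` with `‖c‖ < ε` off all
`Cⱼ` is `Q`-good. Then `Q` is residually escapable at `d` in the sense of the v9 legend `RobustR` (inlined): the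
direction set `⋂ⱼ Cⱼᶜ` is residual and each of its directions is good for `0 < |t| < ε / (‖v‖ + 1)`
(`residual_radialEscape_of_conical`). Countably many curved walls are NOT covered — see
`not_residual_radialEscape_countableWalls`. [folklore] -/
theorem residualOfConicalWalls :
    ∀ (X : Type) [TopologicalSpace X] [ChartedSpace E3 X] [IsManifold (𝓡 3) ∞ X] [T2Space X]
    [SecondCountableTopology X] [ConnectedSpace X] (d : InitialDataSet (𝓡 3) X) (Q : InitialDataSet
    (𝓡 3) X → Prop), (∀ (m : ℕ) (G : EuclideanSpace ℝ (Fin m) → InitialDataSet (𝓡 3) X),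
    (InitialDataSet.IsSmoothDataFamily m G ∧ G 0 = d ∧ (∀ c, G c ∈ admissibleVacuumData X) ∧ ∃ K :
    Set X, IsCompact K ∧ ∀ c, ∀ x ∉ K, (G c).h.inner x = d.h.inner x ∧ (G c).k x = d.k x) → ∃ (n :
    ℕ) (G₁ : EuclideanSpace ℝ (Fin n) → InitialDataSet (𝓡 3) X) (L : EuclideanSpace ℝ (Fin m) →ₗ[ℝ]
    EuclideanSpace ℝ (Fin n)), Function.Injective L ∧ (InitialDataSet.IsSmoothDataFamily n G₁ ∧ G₁ 0
    = d ∧ (∀ c, G₁ c ∈ admissibleVacuumData X) ∧ ∃ K : Set X, IsCompact K ∧ ∀ c, ∀ x ∉ K, (G₁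
    c).h.inner x = d.h.inner x ∧ (G₁ c).k x = d.k x) ∧ (∀ c, G₁ (L c) = G c) ∧ ∀ (p : ℕ) (G₂ :
    EuclideanSpace ℝ (Fin p) → InitialDataSet (𝓡 3) X) (L' : EuclideanSpace ℝ (Fin n) →ₗ[ℝ]
    EuclideanSpace ℝ (Fin p)), Function.Injective L' → (InitialDataSet.IsSmoothDataFamily p G₂ ∧ G₂
    0 = d ∧ (∀ c, G₂ c ∈ admissibleVacuumData X) ∧ ∃ K : Set X, IsCompact K ∧ ∀ c, ∀ x ∉ K, (G₂
    c).h.inner x = d.h.inner x ∧ (G₂ c).k x = d.k x) → (∀ c, G₂ (L' c) = G₁ c) →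
    ∃ (C : ℕ → Set (EuclideanSpace ℝ (Fin p))) (ε : ℝ), 0 < ε ∧ (∀ j, IsClosed (C j)) ∧
    (∀ j, Dense (C j)ᶜ) ∧ (∀ j (v : EuclideanSpace ℝ (Fin p)) (t : ℝ), t ≠ 0 → t • v ∈ C j → v ∈ C j) ∧
    ∀ c : EuclideanSpace ℝ (Fin p), ‖c‖ < ε → (∀ j, c ∉ C j) → Q (G₂ c)) →
    ∀ (m : ℕ) (G : EuclideanSpace ℝ (Fin m) → InitialDataSet (𝓡 3) X),
    (InitialDataSet.IsSmoothDataFamily m G ∧ G 0 = d ∧ (∀ c, G c ∈ admissibleVacuumData X) ∧ ∃ K :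
    Set X, IsCompact K ∧ ∀ c, ∀ x ∉ K, (G c).h.inner x = d.h.inner x ∧ (G c).k x = d.k x) → ∃ (n :
    ℕ) (G₁ : EuclideanSpace ℝ (Fin n) → InitialDataSet (𝓡 3) X) (L : EuclideanSpace ℝ (Fin m) →ₗ[ℝ]
    EuclideanSpace ℝ (Fin n)), Function.Injective L ∧ (InitialDataSet.IsSmoothDataFamily n G₁ ∧ G₁ 0
    = d ∧ (∀ c, G₁ c ∈ admissibleVacuumData X) ∧ ∃ K : Set X, IsCompact K ∧ ∀ c, ∀ x ∉ K, (G₁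
    c).h.inner x = d.h.inner x ∧ (G₁ c).k x = d.k x) ∧ (∀ c, G₁ (L c) = G c) ∧ ∀ (p : ℕ) (G₂ :
    EuclideanSpace ℝ (Fin p) → InitialDataSet (𝓡 3) X) (L' : EuclideanSpace ℝ (Fin n) →ₗ[ℝ]
    EuclideanSpace ℝ (Fin p)), Function.Injective L' → (InitialDataSet.IsSmoothDataFamily p G₂ ∧ G₂
    0 = d ∧ (∀ c, G₂ c ∈ admissibleVacuumData X) ∧ ∃ K : Set X, IsCompact K ∧ ∀ c, ∀ x ∉ K, (G₂
    c).h.inner x = d.h.inner x ∧ (G₂ c).k x = d.k x) → (∀ c, G₂ (L' c) = G₁ c) → ∃ U : Set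
    (EuclideanSpace ℝ (Fin p)), U ∈ residual (EuclideanSpace ℝ (Fin p)) ∧ ∀ v ∈ U, ∃ δ : ℝ, 0 < δ ∧
    ∀ t : ℝ, t ≠ 0 → |t| < δ → Q (G₂ (t • v)) := by
  intro X _ _ _ _ _ _ d Q h m G hG
  obtain ⟨n, G₁, L, hL, hT, hGL, H⟩ := h m G hG
  refine ⟨n, G₁, L, hL, hT, hGL, fun p G₂ L' hL' hT₂ hGL' => ?_⟩
  obtain ⟨C, ε, hε, hC, hCd, hrad, hgood⟩ := H p G₂ L' hL' hT₂ hGL'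
  exact residual_radialEscape_of_conical (fun c => Q (G₂ c)) C ε hε hC hCd hrad hgood

/-- **Countably many curved walls through the datum are NOT escaped residually** (radial accumulation). There is a
sequence of polynomial functions `φⱼ : ℝ² → ℝ`, here `φⱼ(c) = c₁ − (j+1)·c₀²`, each smooth of every order, vanishing
at `0` with non-zero differential at `0` — so `{φⱼ = 0}` are countably many analytic hypersurfaces through the datum,
each non-degenerate there: the literal countable version of the hypothesis block of `stub_robustOfWalls` — such that NO
residual set of directions `v` admits a radius `δ > 0` with `φⱼ(t • v) ≠ 0` for all `j` and all `0 < |t| < δ`.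
Indeed along a direction with `v₀ ≠ 0 < v₁` the wall `j` is met at the parameter `t = v₁ / ((j+1) v₀²)`, which
tends to `0`; and a residual subset of the Baire space `ℝ²` is dense, hence meets the open quadrant `{0 < v₀, 0 < v₁}`.
So the v9 residual legend does not tolerate countably many `C¹` strata through `d` in general (only conical ones,
`residual_radialEscape_of_conical`). [folklore] -/
theorem not_residual_radialEscape_countableWalls :
    ∃ φ : ℕ → EuclideanSpace ℝ (Fin 2) → ℝ,
      (∀ (n : WithTop ℕ∞) (j : ℕ), ContDiff ℝ n (φ j)) ∧ (∀ j, φ j 0 = 0) ∧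
      (∀ j, fderiv ℝ (φ j) 0 ≠ 0) ∧
      ¬ ∃ U : Set (EuclideanSpace ℝ (Fin 2)), U ∈ residual (EuclideanSpace ℝ (Fin 2)) ∧
        ∀ v ∈ U, ∃ δ : ℝ, 0 < δ ∧ ∀ t : ℝ, t ≠ 0 → |t| < δ → ∀ j, φ j (t • v) ≠ 0 := by
  refine ⟨fun j c => c 1 - ((j : ℝ) + 1) * (c 0) ^ 2, ?_, ?_, ?_, ?_⟩
  · -- smooth of every order: a polynomial in the two coordinate functionals
    intro n j
    exact (EuclideanSpace.proj (𝕜 := ℝ) (ι := Fin 2) 1).contDiff.sub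
      (contDiff_const.mul ((EuclideanSpace.proj (𝕜 := ℝ) (ι := Fin 2) 0).contDiff.pow 2))
  · intro j
    simp
  · -- non-degenerate at `0`: the restriction to the line `t ↦ t • e₁` is the identity
    intro j hD
    have hD' : fderiv ℝ (fun c : EuclideanSpace ℝ (Fin 2) => c 1 - ((j : ℝ) + 1) * (c 0) ^ 2) 0 = 0 := hD
    set e₁ : EuclideanSpace ℝ (Fin 2) := EuclideanSpace.single 1 1 with he₁
    have hdiff : Differentiable ℝ (fun c : EuclideanSpace ℝ (Fin 2) => c 1 - ((j : ℝ) + 1) * (c 0) ^ 2) :=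
      ((EuclideanSpace.proj (𝕜 := ℝ) (ι := Fin 2) 1).contDiff.sub
        (contDiff_const.mul ((EuclideanSpace.proj (𝕜 := ℝ) (ι := Fin 2) 0).contDiff.pow 2))).differentiable
          one_ne_zero
    have hline : HasDerivAt (fun s : ℝ => s • e₁) ((1 : ℝ) • e₁) 0 := (hasDerivAt_id (0 : ℝ)).smul_const e₁
    rw [one_smul] at hline
    have hcomp := (hdiff ((0 : ℝ) • e₁)).hasFDerivAt.comp_hasDerivAt (0 : ℝ) hline
    rw [zero_smul, hD', zero_apply] at hcomp
    have hid : HasDerivAt (fun s : ℝ => s) 1 0 := hasDerivAt_id 0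
    have hfun : ((fun c : EuclideanSpace ℝ (Fin 2) => c 1 - ((j : ℝ) + 1) * (c 0) ^ 2) ∘ fun s : ℝ => s • e₁) =
        fun s : ℝ => s := by
      funext s
      simp [he₁]
    rw [hfun] at hcomp
    exact one_ne_zero (hid.unique hcomp)
  · -- radial accumulation in the open quadrant, which every residual (hence dense) set meets
    rintro ⟨U, hU, hgood⟩
    have hWo : IsOpen {v : EuclideanSpace ℝ (Fin 2) | 0 < v 0 ∧ 0 < v 1} :=
      (isOpen_lt continuous_const (EuclideanSpace.proj (𝕜 := ℝ) (ι := Fin 2) 0).continuous).inter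
        (isOpen_lt continuous_const (EuclideanSpace.proj (𝕜 := ℝ) (ι := Fin 2) 1).continuous)
    set w : EuclideanSpace ℝ (Fin 2) := EuclideanSpace.single 0 1 + EuclideanSpace.single 1 1 with hw
    have hwW : w ∈ {v : EuclideanSpace ℝ (Fin 2) | 0 < v 0 ∧ 0 < v 1} := by
      constructor <;> simp [hw]
    obtain ⟨v, hvU, hva, hvb⟩ := (dense_of_mem_residual hU).exists_mem_open hWo ⟨w, hwW⟩
    obtain ⟨δ, hδ, hδgood⟩ := hgood v hvU
    -- the wall index `j` with `t_j = v₁ / ((j+1) v₀²) < δ`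
    set a : ℝ := v 0 with ha
    set b : ℝ := v 1 with hb
    have ha2 : 0 < a ^ 2 := by positivity
    obtain ⟨j, hj⟩ : ∃ j : ℕ, b / (δ * a ^ 2) < (j : ℝ) + 1 :=
      ⟨⌈b / (δ * a ^ 2)⌉₊, (Nat.le_ceil _).trans_lt (lt_add_one _)⟩
    have hj1 : (0 : ℝ) < (j : ℝ) + 1 := by positivity
    set t : ℝ := b / (((j : ℝ) + 1) * a ^ 2) with ht
    have htpos : 0 < t := div_pos hvb (mul_pos hj1 ha2)
    have htδ : |t| < δ := by
      rw [abs_of_pos htpos, ht, div_lt_iff₀ (mul_pos hj1 ha2)]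
      have := (div_lt_iff₀ (mul_pos hδ ha2)).1 hj
      nlinarith
    refine hδgood t htpos.ne' htδ j ?_
    -- on the wall: `φⱼ (t • v) = t·b − (j+1)·(t·a)² = t·(b − (j+1)·t·a²) = 0`
    show (t • v) 1 - ((j : ℝ) + 1) * ((t • v) 0) ^ 2 = 0
    simp only [PiLp.smul_apply, smul_eq_mul, ← ha, ← hb]
    rw [ht]
    field_simp
    ring

end Summit.FinalStateConjecture.FinalStateConjecture.Theorems.PhotonSphereChannels.TameCensorshipUnwind

end
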